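import Literature.Geometry.Lorentzian.LateChartDilation
import Literature.Geometry.Lorentzian.BoostedKerrDilation
import Literature.Geometry.Lorentzian.FinalState
import Summits.FinalStateConjecture.FinalStateConjecture.Statement

/-!
# Dilation covariance of `N`-black-hole final state decompositions
# (helper for stub `stub_scaleCovariance`, line `old-light-forces-soft-burial`, item `CaptureSuffices`,
# stmt-FinalStateConjecture-9953, route `PhaseMixingCapture`)

Let `𝓢 = (M, g, τ)` be a spacetime and `c > 0`. A final state decomposition of a region `O` of the
RESCALED spacetime `(M, c² g, τ)` (`Spacetime.constSmul`) in `Cᵏ` — `N` late-time charts modelled on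
boosted Kerr exteriors `(Λᵢ, cᵢ, Mᵢ, aᵢ)`, a flat chart on `U₀ ⊆ ℝ⁴`, near-zone and radiation-zone
convergence, separation, excision, covering — is transported to a final state decomposition of the
SAME region of `(M, g, τ)` by precomposing every chart with the dilation `y ↦ c y` of `ℝ⁴`
(`LateChartDilation.lean`): hole `i` becomes the boosted Kerr exterior
`(Λᵢ, c⁻¹cᵢ, c⁻¹Mᵢ, c⁻¹aᵢ)` (homogeneity of the Kerr–Schild family, `BoostedKerrDilation.lean`), the
flat domain becomes `c⁻¹ U₀`, the late time `c⁻¹ τ₀`, the excision radii `c⁻¹ ρᵢ(c t)`; all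
images of (truncated) late regions and slabs are unchanged as subsets of `M`, and so are causal
pasts (`causalPast_constSmul`). Main statement: `exists_finalStateDecomposition_of_constSmul` — the
transported decomposition exists, has the same charted late region, sub-extremal holes if the
original has, and exhaustive charts (`Summit.FinalStateConjecture.HasExhaustiveCharts`) if the
original has. No definitions (the transported structure is built inside the proof), no named facts.

References: Dafermos–Holzegel–Rodnianski–Taylor arXiv:2104.08222, §1 (the notions);
Kerr–Schild 1965, §2 (scale covariance); O'Neill 1983, Ch. 14 (conformal invariance of causality).
-/

-- the doubled `FinalStateConjecture.FinalStateConjecture` path component trips dupNamespace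
set_option linter.dupNamespace false

noncomputable section

open Set Filter Topology TopologicalSpace
open scoped Manifold ContDiff

namespace Summit.FinalStateConjecture.FinalStateConjecture.Theorems.CaptureSuffices.ScaleCovariance

open Literature.Geometry.Lorentzian

universe u

/-! ## §1 Growing near zones under the dilation -/

section Dilate

variable {c : ℝ} (hc : 0 < c) {B B' : ModelBackground} {δ : B'.domain → B.domain}
  (hδ : ∀ x, (δ x : E4) = c • (x : E4))
  (htime : ∀ y : E4, B.time (c • y) = c * B'.time y)
  (hrad : ∀ y : E4, B.radius (c • y) = c * B'.radius y)
include hc hδ htime hrad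

/-- GROWING near zones correspond under the dilation: with radii `R'(t') = c⁻¹ R(c t')`,
`δ x ∈ {t > c τ₁, r ≤ R(t)} ↔ x ∈ {t' > τ₁, r' ≤ R'(t')}` (the shape of the certified late regions of
`Summit.FinalStateConjecture.certifiedLate`). [folklore] -/
theorem dilate_mem_nearZone_iff (R : ℝ → ℝ) (τ₁ : ℝ) (x : B'.domain) :
    δ x ∈ {y : B.domain | c * τ₁ < B.time y.1 ∧ B.radius y.1 ≤ R (B.time y.1)} ↔
      x ∈ {y : B'.domain | τ₁ < B'.time y.1 ∧ B'.radius y.1 ≤ c⁻¹ * R (c * B'.time y.1)} := by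
  simp only [mem_setOf_eq]
  rw [time_dilate hδ htime, radius_dilate hδ hrad]
  refine and_congr (mul_lt_mul_iff_right₀ hc) ?_
  rw [inv_mul_eq_div, le_div_iff₀ hc, mul_comm _ c]

end Dilate

/-! ## §2 The two dilations: boosted Kerr exteriors and the flat domain -/

section Backgrounds

variable {c : ℝ} (hc : 0 < c)
include hc

/-- **Dilation between boosted Kerr exteriors**: `y ↦ c y` maps the exterior of
`(Λ, c⁻¹c₀, c⁻¹M, c⁻¹a)` onto that of `(Λ, c₀, M, a)`, intertwining the Kerr–Schild forms, the
rest-frame times (factor `c`) and radii (factor `c`). [folklore] -/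
theorem exists_dilate_boostedKerr (Λ : lorentzGroup) (c₀ : E4) (M a : ℝ) :
    ∃ δ : (boostedKerrBackground Λ (c⁻¹ • c₀) (c⁻¹ * M) (c⁻¹ * a)).domain →
        (boostedKerrBackground Λ c₀ M a).domain,
      (∀ x, (δ x : E4) = c • (x : E4)) ∧
      (∀ y : E4, y ∈ (boostedKerrBackground Λ (c⁻¹ • c₀) (c⁻¹ * M) (c⁻¹ * a)).domain ↔
        c • y ∈ (boostedKerrBackground Λ c₀ M a).domain) ∧
      (∀ y : E4, (boostedKerrBackground Λ (c⁻¹ • c₀) (c⁻¹ * M) (c⁻¹ * a)).bilin y =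
        (boostedKerrBackground Λ c₀ M a).bilin (c • y)) ∧
      (∀ y : E4, (boostedKerrBackground Λ c₀ M a).time (c • y) =
        c * (boostedKerrBackground Λ (c⁻¹ • c₀) (c⁻¹ * M) (c⁻¹ * a)).time y) ∧
      (∀ y : E4, (boostedKerrBackground Λ c₀ M a).radius (c • y) =
        c * (boostedKerrBackground Λ (c⁻¹ • c₀) (c⁻¹ * M) (c⁻¹ * a)).radius y) :=
  ⟨fun x ↦ ⟨c • (x : E4), (smul_mem_boostedKerrExterior_iff_inv hc Λ c₀ M a (x : E4)).2 x.2⟩,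
    fun _ ↦ rfl,
    fun y ↦ (smul_mem_boostedKerrExterior_iff_inv hc Λ c₀ M a y).symm,
    fun y ↦ (boostedKerrBilin_smul_inv hc Λ c₀ M a y).symm,
    fun y ↦ boostedKerrBackground_time_smul_inv hc Λ c₀ M a y,
    fun y ↦ boostedKerrBackground_radius_smul_inv hc Λ c₀ M a y⟩

/-- **Dilation of the flat domain**: for an open `U₀ ⊆ ℝ⁴` there is an open `U₀' = c⁻¹ U₀` such that
`y ↦ c y` maps `U₀'` onto `U₀`, intertwining the Minkowski forms (constant), the times `x⁰`
(factor `c`) and the spatial radii (factor `c`). [folklore] -/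
theorem exists_dilate_minkowski (U₀ : Opens E4) :
    ∃ (U₀' : Opens E4) (δ : (Minkowski.backgroundOn U₀').domain → (Minkowski.backgroundOn U₀).domain),
      (∀ x, (δ x : E4) = c • (x : E4)) ∧
      (∀ y : E4, y ∈ (Minkowski.backgroundOn U₀').domain ↔
        c • y ∈ (Minkowski.backgroundOn U₀).domain) ∧
      (∀ y : E4, (Minkowski.backgroundOn U₀').bilin y = (Minkowski.backgroundOn U₀).bilin (c • y)) ∧
      (∀ y : E4, (Minkowski.backgroundOn U₀).time (c • y) =
        c * (Minkowski.backgroundOn U₀').time y) ∧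
      (∀ y : E4, (Minkowski.backgroundOn U₀).radius (c • y) =
        c * (Minkowski.backgroundOn U₀').radius y) := by
  refine ⟨⟨(fun y : E4 ↦ c • y) ⁻¹' (U₀ : Set E4), U₀.isOpen.preimage (continuous_const_smul c)⟩,
    fun x ↦ ⟨c • (x : E4), x.2⟩, fun _ ↦ rfl, fun _ ↦ Iff.rfl, fun _ ↦ rfl, fun y ↦ ?_, fun y ↦ ?_⟩
  · change (c • y) 0 = c * y 0
    simp
  · change E4.spatialNorm (c • y) = c * E4.spatialNorm y
    rw [Kerr.spatialNorm_smul, abs_of_pos hc]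

end Backgrounds

/-! ## §3 Causal pasts -/

section Causal

variable (𝓢 : Spacetime.{u} 4)

/-- `J⁻` of the rescaled spacetime `(M, c² g, τ)` is `J⁻` of `(M, g, τ)`. [folklore] -/
theorem causalPast_constSmul_spacetime {c : ℝ} (hc : 0 < c) (S : Set 𝓢.carrier) :
    (𝓢.constSmul (c ^ 2) (pow_pos hc 2)).metric.causalPast
        (𝓢.constSmul (c ^ 2) (pow_pos hc 2)).timeOrientation S =
      𝓢.metric.causalPast 𝓢.timeOrientation S :=
  LorentzianMetric.causalPast_constSmul 𝓢.metric 𝓢.timeOrientation (pow_pos hc 2) S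

/-- `J⁻` is monotone in the set. O'Neill 1983, Ch. 14, p. 403. [folklore] -/
theorem causalPast_mono {S T : Set 𝓢.carrier} (h : S ⊆ T) :
    𝓢.metric.causalPast 𝓢.timeOrientation S ⊆ 𝓢.metric.causalPast 𝓢.timeOrientation T := by
  unfold LorentzianMetric.causalPast
  exact LorentzianMetric.causalFuture_mono h

end Causal

/-! ## §4 Transport of a final state decomposition along the dilation -/

section Transport

variable {𝓢 : Spacetime.{u} 4} {c : ℝ} (hc : 0 < c)

include hc in
/-- Sublinear growth of the excision radii transfers: `(c⁻¹ ρ(c t)) / t = ρ(c t) / (c t) → 0`.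
[folklore] -/
theorem tendsto_excision_dilate {ρ : ℝ → ℝ} (h : Tendsto (fun t ↦ ρ t / t) atTop (𝓝 0)) :
    Tendsto (fun t ↦ c⁻¹ * ρ (c * t) / t) atTop (𝓝 0) := by
  have h' := h.comp (tendsto_id.const_mul_atTop hc)
  refine Tendsto.congr (fun t ↦ ?_) h'
  simp only [Function.comp_apply, id_eq]
  ring

include hc in
/-- Sub-extremality `|a| < M` is invariant under `(M, a) ↦ (c⁻¹ M, c⁻¹ a)`. [folklore] -/
theorem isSubextremal_smul_inv {M a : ℝ} (h : Kerr.IsSubextremal M a) :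
    Kerr.IsSubextremal (c⁻¹ * M) (c⁻¹ * a) := by
  unfold Kerr.IsSubextremal at h ⊢
  rw [abs_mul, abs_of_pos (inv_pos.2 hc)]
  exact mul_lt_mul_of_pos_left h (inv_pos.2 hc)

end Transport

section Main

/-- **Transport of a final state decomposition along the dilation.** A `Cᵏ` final state
decomposition `d'` of the region `O` of the rescaled spacetime `(M, c² g, τ)` yields one of the same
region of `(M, g, τ)` — charts precomposed with `y ↦ c y`, parameters `(Λᵢ, c⁻¹cᵢ, c⁻¹Mᵢ, c⁻¹aᵢ)`,
late time `c⁻¹τ₀`, excision `c⁻¹ρᵢ(c t)`, flat domain `c⁻¹U₀` — with the SAME charted late region,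
sub-extremal holes if those of `d'` are, and exhaustive charts if those of `d'` are (radii
`c⁻¹Rᵢ(c τ)`). All set identities are proved pointwise (images of corresponding regions under
surjective dilations). DHRT arXiv:2104.08222, §1; Kerr–Schild 1965, §2. [folklore] -/
theorem exists_finalStateDecomposition_of_constSmul :
    ∀ {𝓢 : Spacetime 4} {c : ℝ} (hc : 0 < c) {O : Set 𝓢.carrier} {k : ℕ}
      (d' : FinalStateDecomposition (𝓢.constSmul (c ^ 2) (pow_pos hc 2)) O k),
      ∃ d : FinalStateDecomposition 𝓢 O k,
        d.charted = d'.charted ∧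
          ((∀ i, Kerr.IsSubextremal (d'.mass i) (d'.spin i)) →
            ∀ i, Kerr.IsSubextremal (d.mass i) (d.spin i)) ∧
          (Summit.FinalStateConjecture.HasExhaustiveCharts d' →
            Summit.FinalStateConjecture.HasExhaustiveCharts d) := by
  intro 𝓢 c hc O k d'
  have hc0 : c ≠ 0 := hc.ne'
  -- the dilations of the hole backgrounds and of the flat domain
  choose δh hδh hdomh hbilh htimeh hradh using fun i : Fin d'.N ↦
    exists_dilate_boostedKerr hc (d'.motion i).1 (d'.motion i).2 (d'.mass i) (d'.spin i)
  obtain ⟨U, δ0, hδ0, hdom0, hbil0, htime0, hrad0⟩ := exists_dilate_minkowski hc d'.flatDomain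
  have hsurjh : ∀ i, Function.Surjective (δh i) := fun i ↦ surjective_dilate hc0 (hδh i) (hdomh i)
  have hsurj0 : Function.Surjective δ0 := surjective_dilate hc0 hδ0 hdom0
  have hsm : ∀ i, ContMDiff 𝓘(ℝ, E4) (𝓡 4) ∞ (d'.chart i) := fun i ↦ (d'.isLateChart i).contMDiff
  have hsm0 : ContMDiff 𝓘(ℝ, E4) (𝓡 4) ∞ d'.flatChart := d'.isLateChart_flat.contMDiff
  -- membership correspondences at the initial late time `τ₀ = c (c⁻¹ τ₀)`
  have hτ : c * (c⁻¹ * d'.τ₀) = d'.τ₀ := mul_inv_cancel_left₀ hc0 _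
  have hmem_late : ∀ i x, δh i x ∈ (boostedKerrBackground (d'.motion i).1 (d'.motion i).2
      (d'.mass i) (d'.spin i)).lateRegion d'.τ₀ ↔ x ∈ (boostedKerrBackground (d'.motion i).1
      (c⁻¹ • (d'.motion i).2) (c⁻¹ * d'.mass i) (c⁻¹ * d'.spin i)).lateRegion (c⁻¹ * d'.τ₀) :=
    fun i x ↦ by
      have h := dilate_mem_lateRegion_iff hc (hδh i) (htimeh i) (c⁻¹ * d'.τ₀) x
      rwa [hτ] at h
  have hmem_slab : ∀ i x, δh i x ∈ (boostedKerrBackground (d'.motion i).1 (d'.motion i).2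
      (d'.mass i) (d'.spin i)).timeSlab d'.τ₀ ↔ x ∈ (boostedKerrBackground (d'.motion i).1
      (c⁻¹ • (d'.motion i).2) (c⁻¹ * d'.mass i) (c⁻¹ * d'.spin i)).timeSlab (c⁻¹ * d'.τ₀) :=
    fun i x ↦ by
      have h := dilate_mem_timeSlab_iff hc (hδh i) (htimeh i) (c⁻¹ * d'.τ₀) x
      rwa [hτ] at h
  have hmem_late0 : ∀ x, δ0 x ∈ (Minkowski.backgroundOn d'.flatDomain).lateRegion d'.τ₀ ↔
      x ∈ (Minkowski.backgroundOn U).lateRegion (c⁻¹ * d'.τ₀) := fun x ↦ by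
    have h := dilate_mem_lateRegion_iff hc hδ0 htime0 (c⁻¹ * d'.τ₀) x
    rwa [hτ] at h
  have hmem_slab0 : ∀ x, δ0 x ∈ (Minkowski.backgroundOn d'.flatDomain).timeSlab d'.τ₀ ↔
      x ∈ (Minkowski.backgroundOn U).timeSlab (c⁻¹ * d'.τ₀) := fun x ↦ by
    have h := dilate_mem_timeSlab_iff hc hδ0 htime0 (c⁻¹ * d'.τ₀) x
    rwa [hτ] at h
  -- the fields of the transported decomposition, proved one by one (so that the structure
  -- literal below stays small)
  have hF_spin : ∀ i, |c⁻¹ * d'.spin i| ≤ c⁻¹ * d'.mass i := fun i ↦ by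
    rw [abs_mul, abs_of_pos (inv_pos.2 hc)]
    exact mul_le_mul_of_nonneg_left (d'.abs_spin_le_mass i) (inv_pos.2 hc).le
  have hF_late : ∀ i, 𝓢.IsLateChart (boostedKerrBackground (d'.motion i).1
      (c⁻¹ • (d'.motion i).2) (c⁻¹ * d'.mass i) (c⁻¹ * d'.spin i)) O (c⁻¹ * d'.τ₀)
      (d'.chart i ∘ δh i) := fun i ↦
    𝓢.isLateChart_comp_dilate hc (hδh i) (hdomh i) (htimeh i) (d'.isLateChart i)
  have hF_trunc : ∀ i (R : ℝ), Tendsto (fun τ ↦ 𝓢.truncDeviationCk (boostedKerrBackground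
      (d'.motion i).1 (c⁻¹ • (d'.motion i).2) (c⁻¹ * d'.mass i) (c⁻¹ * d'.spin i))
      (d'.chart i ∘ δh i) k R τ) atTop (𝓝 0) := fun i R ↦ by
    have h := 𝓢.tendsto_truncDeviationCk_comp_dilate hc (hδh i) (hdomh i) (hbilh i) (htimeh i)
      (hradh i) (hsm i) (R := fun _ ↦ c * R) (d'.tendsto_truncDeviationCk i (c * R))
    simp only [inv_mul_cancel_left₀ hc0] at h
    exact h
  have hF_disj : ∀ R : ℝ, ∃ τ₁ : ℝ, Pairwise (Function.onFun Disjoint fun i ↦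
      (d'.chart i ∘ δh i) '' (boostedKerrBackground (d'.motion i).1 (c⁻¹ • (d'.motion i).2)
        (c⁻¹ * d'.mass i) (c⁻¹ * d'.spin i)).truncLateRegion τ₁ R) := fun R ↦ by
    obtain ⟨τ₁, hτ₁⟩ := d'.exists_pairwise_disjoint (c * R)
    -- the new truncated tubes after `c⁻¹ τ₁` sit inside the old ones after `τ₁`
    have htube : ∀ i, (d'.chart i ∘ δh i) '' (boostedKerrBackground (d'.motion i).1
        (c⁻¹ • (d'.motion i).2) (c⁻¹ * d'.mass i) (c⁻¹ * d'.spin i)).truncLateRegion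
          (c⁻¹ * τ₁) R ⊆
        d'.chart i '' (boostedKerrBackground (d'.motion i).1 (d'.motion i).2 (d'.mass i)
          (d'.spin i)).truncLateRegion τ₁ (c * R) := fun i ↦ by
      rintro _ ⟨x, hx, rfl⟩
      refine ⟨δh i x, ?_, rfl⟩
      have h := (dilate_mem_truncLateRegion_iff hc (hδh i) (htimeh i) (hradh i) (c⁻¹ * τ₁)
        R x).2 hx
      rwa [mul_inv_cancel_left₀ hc0] at h
    exact ⟨c⁻¹ * τ₁, fun i j hij ↦ Disjoint.mono (htube i) (htube j) (hτ₁ hij)⟩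
  have hF_exc : ∀ i, Tendsto (fun t ↦ c⁻¹ * d'.excision i (c * t) / t) atTop (𝓝 0) := fun i ↦
    tendsto_excision_dilate hc (d'.tendsto_excision_div i)
  have hF_dom : {x : E4 | c⁻¹ * d'.τ₀ < x 0 ∧ ∀ i, c⁻¹ * d'.excision i (c * x 0) <
      Kerr.radius (c⁻¹ * d'.spin i) (poincareInv (d'.motion i).1 (c⁻¹ • (d'.motion i).2) x)} ⊆
      (U : Set E4) := by
    rintro x ⟨hx0, hxi⟩
    have h0 : (c • x) 0 = c * x 0 := by simp
    refine (hdom0 x).2 (d'.setOf_lt_excision_subset_flatDomain ⟨?_, fun i ↦ ?_⟩)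
    · have h2 : d'.τ₀ < c * x 0 := by
        calc d'.τ₀ = c * (c⁻¹ * d'.τ₀) := hτ.symm
          _ < c * x 0 := mul_lt_mul_of_pos_left hx0 hc
      simpa only [h0] using h2
    · have hr : Kerr.radius (d'.spin i) (poincareInv (d'.motion i).1 (d'.motion i).2 (c • x)) =
          c * Kerr.radius (c⁻¹ * d'.spin i)
            (poincareInv (d'.motion i).1 (c⁻¹ • (d'.motion i).2) x) := hradh i x
      have h2 : d'.excision i (c * x 0) <
          Kerr.radius (d'.spin i) (poincareInv (d'.motion i).1 (d'.motion i).2 (c • x)) := by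
        rw [hr]
        calc d'.excision i (c * x 0) = c * (c⁻¹ * d'.excision i (c * x 0)) :=
            (mul_inv_cancel_left₀ hc0 _).symm
          _ < _ := mul_lt_mul_of_pos_left (hxi i) hc
      simpa only [h0] using h2
  have hF_flatLate : 𝓢.IsLateChart (Minkowski.backgroundOn U) O (c⁻¹ * d'.τ₀)
      (d'.flatChart ∘ δ0) :=
    𝓢.isLateChart_comp_dilate hc hδ0 hdom0 htime0 d'.isLateChart_flat
  have hF_flatDev : Tendsto (fun τ ↦ 𝓢.deviationCk (Minkowski.backgroundOn U)
      (d'.flatChart ∘ δ0) k τ) atTop (𝓝 0) :=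
    𝓢.tendsto_deviationCk_comp_dilate hc hδ0 hdom0 hbil0 htime0 hsm0 d'.tendsto_deviationCk_flat
  have hF_cover : O \ ((⋃ i, (d'.chart i ∘ δh i) '' (boostedKerrBackground (d'.motion i).1
        (c⁻¹ • (d'.motion i).2) (c⁻¹ * d'.mass i) (c⁻¹ * d'.spin i)).lateRegion (c⁻¹ * d'.τ₀)) ∪
        (d'.flatChart ∘ δ0) '' (Minkowski.backgroundOn U).lateRegion (c⁻¹ * d'.τ₀)) ⊆
      𝓢.metric.causalPast 𝓢.timeOrientation
        ((⋃ i, (d'.chart i ∘ δh i) '' (boostedKerrBackground (d'.motion i).1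
          (c⁻¹ • (d'.motion i).2) (c⁻¹ * d'.mass i) (c⁻¹ * d'.spin i)).timeSlab (c⁻¹ * d'.τ₀)) ∪
          (d'.flatChart ∘ δ0) '' (Minkowski.backgroundOn U).timeSlab (c⁻¹ * d'.τ₀)) := by
    intro x hx
    -- `x` is not covered by the old late images either
    have hx' : x ∈ O \ ((⋃ i, d'.chart i '' (boostedKerrBackground (d'.motion i).1
        (d'.motion i).2 (d'.mass i) (d'.spin i)).lateRegion d'.τ₀) ∪
        d'.flatChart '' (Minkowski.backgroundOn d'.flatDomain).lateRegion d'.τ₀) := by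
      refine ⟨hx.1, fun hmem ↦ hx.2 ?_⟩
      rcases hmem with hmem | hmem
      · obtain ⟨i, hi⟩ := mem_iUnion.1 hmem
        obtain ⟨z, hz, rfl⟩ := hi
        obtain ⟨z', rfl⟩ := hsurjh i z
        exact Or.inl (mem_iUnion.2 ⟨i, z', (hmem_late i z').1 hz, rfl⟩)
      · obtain ⟨z, hz, rfl⟩ := hmem
        obtain ⟨z', rfl⟩ := hsurj0 z
        exact Or.inr ⟨z', (hmem_late0 z').1 hz, rfl⟩
    -- the old initial slabs are the new initial slabs
    have hsub : ((⋃ i, d'.chart i '' (boostedKerrBackground (d'.motion i).1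
        (d'.motion i).2 (d'.mass i) (d'.spin i)).timeSlab d'.τ₀) ∪
        d'.flatChart '' (Minkowski.backgroundOn d'.flatDomain).timeSlab d'.τ₀ :
          Set 𝓢.carrier) ⊆
        (⋃ i, (d'.chart i ∘ δh i) '' (boostedKerrBackground (d'.motion i).1
          (c⁻¹ • (d'.motion i).2) (c⁻¹ * d'.mass i) (c⁻¹ * d'.spin i)).timeSlab (c⁻¹ * d'.τ₀)) ∪
          (d'.flatChart ∘ δ0) '' (Minkowski.backgroundOn U).timeSlab (c⁻¹ * d'.τ₀) := by
      rintro y (hy | hy)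
      · obtain ⟨i, hi⟩ := mem_iUnion.1 hy
        obtain ⟨z, hz, rfl⟩ := hi
        obtain ⟨z', rfl⟩ := hsurjh i z
        exact Or.inl (mem_iUnion.2 ⟨i, z', (hmem_slab i z').1 hz, rfl⟩)
      · obtain ⟨z, hz, rfl⟩ := hy
        obtain ⟨z', rfl⟩ := hsurj0 z
        exact Or.inr ⟨z', (hmem_slab0 z').1 hz, rfl⟩
    have h' := d'.diff_subset_causalPast hx'
    have h'' := (Set.ext_iff.1 (causalPast_constSmul_spacetime 𝓢 hc _) x).1 h'
    exact causalPast_mono 𝓢 hsub h''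
  -- the transported decomposition (a small literal: data and the facts above)
  refine ⟨
    { N := d'.N
      mass := fun i ↦ c⁻¹ * d'.mass i
      spin := fun i ↦ c⁻¹ * d'.spin i
      mass_pos := fun i ↦ mul_pos (inv_pos.2 hc) (d'.mass_pos i)
      abs_spin_le_mass := hF_spin
      motion := fun i ↦ ((d'.motion i).1, c⁻¹ • (d'.motion i).2)
      τ₀ := c⁻¹ * d'.τ₀
      chart := fun i ↦ d'.chart i ∘ δh i
      isLateChart := hF_late
      tendsto_truncDeviationCk := hF_trunc
      exists_pairwise_disjoint := hF_disj
      excision := fun i t ↦ c⁻¹ * d'.excision i (c * t)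
      tendsto_excision_div := hF_exc
      flatDomain := U
      setOf_lt_excision_subset_flatDomain := hF_dom
      flatChart := d'.flatChart ∘ δ0
      isLateChart_flat := hF_flatLate
      tendsto_deviationCk_flat := hF_flatDev
      diff_subset_causalPast := hF_cover }, ?_,
    fun hsub i ↦ isSubextremal_smul_inv hc (hsub i), fun hex ↦ ?_⟩
  · -- the charted late regions agree
    unfold FinalStateDecomposition.charted
    refine congrArg₂ (· ∪ ·) ?_ (iUnion_congr fun i ↦ ?_)
    · exact image_comp_dilate d'.flatChart hsurj0 hmem_late0
    · exact image_comp_dilate (d'.chart i) (hsurjh i) (hmem_late i)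
  · -- exhaustive charts transfer, radii `max (c⁻¹ Rᵢ(c τ)) (max r₊ᵢ 0 + 1)` (buildfix 2026-08-20: proof
    -- port to the audit-g6 clause `Rᵢ → ∞ ∧ Rᵢ ≥ max r₊ᵢ 0 + 1`; the floor is eventually inactive)
    obtain ⟨R', hgrow, hconv, hcov⟩ := hex
    have hRn : ∀ i, Tendsto (fun τ ↦ c⁻¹ * R' i (c * τ)) atTop atTop := fun i ↦
      Tendsto.const_mul_atTop (inv_pos.2 hc) ((hgrow i).1.comp (Tendsto.const_mul_atTop hc tendsto_id))
    refine ⟨fun i τ ↦ max (c⁻¹ * R' i (c * τ))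
        (max (Kerr.rPlus (c⁻¹ * d'.mass i) (c⁻¹ * d'.spin i)) 0 + 1),
      fun i ↦ ⟨tendsto_atTop_mono (fun τ ↦ le_max_left _ _) (hRn i), fun τ ↦ le_max_right _ _⟩,
      fun i ↦ ?_, fun τ₁ hτ₁ ↦ ?_⟩
    · refine Tendsto.congr' ?_ (𝓢.tendsto_truncDeviationCk_comp_dilate hc (hδh i) (hdomh i)
        (hbilh i) (htimeh i) (hradh i) (hsm i) (hconv i))
      filter_upwards [(hRn i).eventually_ge_atTop
        (max (Kerr.rPlus (c⁻¹ * d'.mass i) (c⁻¹ * d'.spin i)) 0 + 1)] with τ hτ; rw [max_eq_left hτ]; rfl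
    · have h1 : c⁻¹ * d'.τ₀ < τ₁ := hτ₁
      have hτ₁' : d'.τ₀ < c * τ₁ := by
        calc d'.τ₀ = c * (c⁻¹ * d'.τ₀) := hτ.symm
          _ < c * τ₁ := mul_lt_mul_of_pos_left h1 hc
      intro x hx
      -- `x` is outside the old certified late region after `c τ₁`
      have hx' : x ∈ O \ (certifiedLate d' R' (c * τ₁) :) := by
        refine ⟨hx.1, fun hmem ↦ hx.2 ?_⟩
        rcases hmem with hmem | hmem
        · obtain ⟨z, hz, rfl⟩ := hmem
          obtain ⟨z', rfl⟩ := hsurj0 z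
          exact Or.inl ⟨z', (dilate_mem_lateRegion_iff hc hδ0 htime0 τ₁ z').1 hz, rfl⟩
        · obtain ⟨i, hi⟩ := mem_iUnion.1 hmem
          obtain ⟨z, hz, rfl⟩ := hi
          obtain ⟨z', rfl⟩ := hsurjh i z
          have hz' := (dilate_mem_nearZone_iff hc (hδh i) (htimeh i) (hradh i) (R' i) τ₁ z').1 hz
          exact Or.inr (mem_iUnion.2 ⟨i, z', ⟨hz'.1, hz'.2.trans (le_max_left _ _)⟩, rfl⟩)
      -- the old certified slab at `c τ₁` lies inside the new one at `τ₁`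
      have hsub : (certifiedSlab d' R' (c * τ₁) :) ⊆
          (d'.flatChart ∘ δ0) '' (Minkowski.backgroundOn U).timeSlab τ₁ ∪
            ⋃ i, (d'.chart i ∘ δh i) '' (boostedKerrBackground (d'.motion i).1
              (c⁻¹ • (d'.motion i).2) (c⁻¹ * d'.mass i) (c⁻¹ * d'.spin i)).truncTimeSlab
                (max (c⁻¹ * R' i (c * τ₁))
                  (max (Kerr.rPlus (c⁻¹ * d'.mass i) (c⁻¹ * d'.spin i)) 0 + 1)) τ₁ := by
        rintro y (hy | hy)
        · obtain ⟨z, hz, rfl⟩ := hy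
          obtain ⟨z', rfl⟩ := hsurj0 z
          exact Or.inl ⟨z', (dilate_mem_timeSlab_iff hc hδ0 htime0 τ₁ z').1 hz, rfl⟩
        · obtain ⟨i, hi⟩ := mem_iUnion.1 hy
          obtain ⟨z, hz, rfl⟩ := hi
          obtain ⟨z', rfl⟩ := hsurjh i z
          have h3 := dilate_mem_truncTimeSlab_iff hc (hδh i) (htimeh i) (hradh i)
            (c⁻¹ * R' i (c * τ₁)) τ₁ z'
          rw [mul_inv_cancel_left₀ hc0] at h3
          exact Or.inr (mem_iUnion.2 ⟨i, z',
            (ModelBackground.truncTimeSlab_mono _ (le_max_left _ _) τ₁) (h3.1 hz), rfl⟩)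
      -- hence `x` is in the causal past of the new certified slab at `τ₁`
      have h' := hcov (c * τ₁) hτ₁' hx'
      have h'' := (Set.ext_iff.1 (causalPast_constSmul_spacetime 𝓢 hc _) x).1 h'
      exact causalPast_mono 𝓢 hsub h''

end Main

end Summit.FinalStateConjecture.FinalStateConjecture.Theorems.CaptureSuffices.ScaleCovariance

end
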